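import Summits.NavierStokesRegularity.NavierStokesRegularity.Theses.LerayQuarterDissipation
import Summits.NavierStokesRegularity.NavierStokesRegularity.Theorems.LerayQuarterDissipationFiniteDissipationLiouvillePastDss
import Summits.NavierStokesRegularity.NavierStokesRegularity.Theorems.LerayQuarterDissipationFiniteDissipationLiouvilleHardness
import Summits.NavierStokesRegularity.NavierStokesRegularity.Theorems.LerayQuarterDissipationRecurrentDissipativeLiouvilleCriticalRecurrent
import Summits.NavierStokesRegularity.NavierStokesRegularity.Theorems.LerayQuarterDissipationFiniteDissipationLiouvilleEnvelope
import HarnessLib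

/-!
# Crux `FiniteDissipationLiouville` (stmt-NavierStokesRegularity-22144), line `birth`:
# the CLOSING-LEMMA REDUCTION — modulo periodic approximation, the crux IS Bradshaw–Tsai OP 5.1

Theorems file of route `LerayQuarterDissipation` (lead ns-lqd-lead g7), `--supports 22144`; the
companion of `…FiniteDissipationLiouvilleLyapunov.lean`. Navier–Stokes regularity is NOT proved by
anything here; no summit is.

Two classical dynamical routes lead from RECURRENCE to rigidity: a Lyapunov functional (no
non-trivial recurrence at all — typed in `…Lyapunov.lean`: `fdl_iff_exists_lyapunov`) or a
CLOSING LEMMA (recurrent orbits are shadowed by periodic ones — Pugh 1967 for `C¹`-generic flows on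
compact manifolds; nothing of the kind is known for Leray's similarity flow). For the crux the
periodic orbits of the scaling flow `σ ↦ e^σ W(e^{2σ}·, e^σ·)` are exactly the backward
DISCRETELY SELF-SIMILAR fields (`(W_σ)_{log λ} = W_σ`), whose exclusion in the Type-I envelope
class is the catalogued wall `∀ c > 1, Literature.Analysis.FluidPDE.TypeIDSSLiouville c`
(Bradshaw–Tsai 2017 Open Problem 5.1), NECESSARY for the crux (`…Hardness`, ns-lqd-p1).

* `fdl_of_wall_of_closing` — if every singular, uniformly recurrent, enveloped, dissipative
  Type-I ancient mild field (every member of some `𝒮(C,A,K)`) FORCES THE EXISTENCE of a singular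
  past-DSS member of some stratum `𝒟_{C',K'}` (the weakest closing statement: no shadowing, no
  nearness, no control of the factor), then the wall implies the crux (composition through the
  recurrent critical element of ns-lqd-p1 and `…PastDss.pastDssExclusion_of_typeIDSSLiouville`);
* `fdl_iff_wall_of_closing` — so, modulo that closing statement, `FiniteDissipationLiouville` is
  EQUIVALENT to Bradshaw–Tsai OP 5.1 for all factors (the converse is `…Hardness`, unconditional).

Census value: the residue of the crux beyond the DSS wall is PRECISELY the failure of periodic
approximation for singular recurrent members — the "wandering stratum" of leads g2–g6 in one
line. No closing lemma for the Navier–Stokes scaling flow is in print (presearch in the seat's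
NOTES). No definitions; standard axioms.
-/

noncomputable section

-- the summit and its single sub-problem share the name (CONVENTIONS §1), as in every Theorems file
set_option linter.dupNamespace false

namespace Summit.NavierStokesRegularity.NavierStokesRegularity.Theorems.FiniteDissipationLiouville.Lyapunov

open MeasureTheory Set Filter Topology Metric Function
open Literature.Analysis Literature.Analysis.FluidPDE
open Summit.NavierStokesRegularity.NavierStokesRegularity.Theorems.FiniteDissipationLiouville
open scoped ENNReal NNReal

/-- **The wall plus a closing statement give the crux.** If every member of every singular
recurrent envelope class `𝒮(C,A,K)` forces the existence of a SINGULAR past-DSS member of some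
stratum `𝒟_{C',K'}` (factor `c > 1`), then `∀ c > 1, TypeIDSSLiouville c` implies
`FiniteDissipationLiouville`. -/
theorem fdl_of_wall_of_closing
    (hwall : ∀ c : ℝ, 1 < c → TypeIDSSLiouville c)
    (hclose : ∀ (C A K : ℝ) (V : ℝ → EuclideanSpace ℝ (Fin 3) → EuclideanSpace ℝ (Fin 3)),
      IsTypeIAncientMild C V → HasTypeIDecay A V →
      (∀ s : ℝ, s < 0 → ∫⁻ x, ‖fderiv ℝ (V s) x‖ₑ ^ 2 ≤ ENNReal.ofReal (K / Real.sqrt (-s))) →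
      (∀ r > 0, ∀ M : ℝ, ∃ t ∈ Set.Ioo (-(r ^ 2)) (0 : ℝ),
        ∃ x ∈ Metric.ball (0 : EuclideanSpace ℝ (Fin 3)) r, M < ‖V t x‖) →
      (∀ ε > 0, ∀ R > 1, ∃ L > 0, ∀ a : ℝ, ∃ σ ∈ Set.Icc a (a + L),
        ∀ s ∈ Set.Icc (-(R ^ 2)) (-(R⁻¹) ^ 2),
        ∀ y ∈ Metric.closedBall (0 : EuclideanSpace ℝ (Fin 3)) R,
          ‖Real.exp σ • V (Real.exp (2 * σ) * s) (Real.exp σ • y) - V s y‖ ≤ ε) →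
      ∃ (C' K' c : ℝ) (V' : ℝ → EuclideanSpace ℝ (Fin 3) → EuclideanSpace ℝ (Fin 3)),
        1 < c ∧ IsTypeIAncientMild C' V' ∧
        (∀ s : ℝ, s < 0 → ∫⁻ x, ‖fderiv ℝ (V' s) x‖ₑ ^ 2 ≤ ENNReal.ofReal (K' / Real.sqrt (-s))) ∧
        (∀ t : ℝ, t < 0 → ∀ x, c • V' (c ^ 2 * t) (c • x) = V' t x) ∧
        (∀ r > 0, ∀ M : ℝ, ∃ t ∈ Set.Ioo (-(r ^ 2)) (0 : ℝ),
          ∃ x ∈ Metric.ball (0 : EuclideanSpace ℝ (Fin 3)) r, M < ‖V' t x‖)) :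
    Theses.LerayQuarterDissipation.FiniteDissipationLiouville := by
  intro C K ū hū hD hsing
  -- the recurrent critical element and its envelope
  obtain ⟨K₁, -, hce⟩ := CriticalElement.exists_recurrent_criticalElement
  obtain ⟨Kc, w, -, -, hw, hDw, hsw, hrec, hmin, -⟩ := hce C K ū hū hD hsing
  obtain ⟨A, -, hA⟩ := Envelope.envelope_of_minimal hmin
  -- closing: a singular past-DSS member somewhere; the wall excludes it
  obtain ⟨C', K', c, V', hc, hV', hDV', hpast, hsingV'⟩ :=
    hclose C A Kc w hw (hA w hw hDw hsw) hDw hsw hrec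
  exact Birth.pastDssExclusion_of_typeIDSSLiouville hwall C' K' c V' hc hV' hDV' hpast hsingV'

/-- **Modulo the closing statement, the crux IS Bradshaw–Tsai OP 5.1 (all factors).** The
converse direction `FiniteDissipationLiouville → ∀ c > 1, TypeIDSSLiouville c` is unconditional
(`…Hardness.typeIDSSLiouville_of_finiteDissipationLiouville`, ns-lqd-p1). -/
theorem fdl_iff_wall_of_closing
    (hclose : ∀ (C A K : ℝ) (V : ℝ → EuclideanSpace ℝ (Fin 3) → EuclideanSpace ℝ (Fin 3)),
      IsTypeIAncientMild C V → HasTypeIDecay A V →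
      (∀ s : ℝ, s < 0 → ∫⁻ x, ‖fderiv ℝ (V s) x‖ₑ ^ 2 ≤ ENNReal.ofReal (K / Real.sqrt (-s))) →
      (∀ r > 0, ∀ M : ℝ, ∃ t ∈ Set.Ioo (-(r ^ 2)) (0 : ℝ),
        ∃ x ∈ Metric.ball (0 : EuclideanSpace ℝ (Fin 3)) r, M < ‖V t x‖) →
      (∀ ε > 0, ∀ R > 1, ∃ L > 0, ∀ a : ℝ, ∃ σ ∈ Set.Icc a (a + L),
        ∀ s ∈ Set.Icc (-(R ^ 2)) (-(R⁻¹) ^ 2),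
        ∀ y ∈ Metric.closedBall (0 : EuclideanSpace ℝ (Fin 3)) R,
          ‖Real.exp σ • V (Real.exp (2 * σ) * s) (Real.exp σ • y) - V s y‖ ≤ ε) →
      ∃ (C' K' c : ℝ) (V' : ℝ → EuclideanSpace ℝ (Fin 3) → EuclideanSpace ℝ (Fin 3)),
        1 < c ∧ IsTypeIAncientMild C' V' ∧
        (∀ s : ℝ, s < 0 → ∫⁻ x, ‖fderiv ℝ (V' s) x‖ₑ ^ 2 ≤ ENNReal.ofReal (K' / Real.sqrt (-s))) ∧
        (∀ t : ℝ, t < 0 → ∀ x, c • V' (c ^ 2 * t) (c • x) = V' t x) ∧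
        (∀ r > 0, ∀ M : ℝ, ∃ t ∈ Set.Ioo (-(r ^ 2)) (0 : ℝ),
          ∃ x ∈ Metric.ball (0 : EuclideanSpace ℝ (Fin 3)) r, M < ‖V' t x‖)) :
    Theses.LerayQuarterDissipation.FiniteDissipationLiouville ↔
      ∀ c : ℝ, 1 < c → TypeIDSSLiouville c :=
  ⟨fun h c _ => Hardness.typeIDSSLiouville_of_finiteDissipationLiouville h c,
    fun hwall => fdl_of_wall_of_closing hwall hclose⟩

end Summit.NavierStokesRegularity.NavierStokesRegularity.Theorems.FiniteDissipationLiouville.Lyapunov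

end
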